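import Mathlib
import Summits.Ventures.PercRepro2.Defs
import Summits.Ventures.PercRepro2.Independence
import Summits.Ventures.PercRepro2.Harris
import Summits.Ventures.PercRepro2.CoinDefs
import Summits.Ventures.PercRepro2.CoinArcsOff
import Summits.Ventures.PercRepro2.CoinPendantDefs
import Summits.Ventures.PercRepro2.CoinPendant
import Summits.Ventures.PercRepro2.CoinInduced
import Summits.Ventures.PercRepro2.CoinVdBK
import Summits.Ventures.PercRepro2.CoinBHK
import Summits.Ventures.PercRepro2.CoinReverse
import Summits.Ventures.PercRepro2.CoinLemmaA
import Summits.Ventures.PercRepro2.CoinDarcMixed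
import Summits.Ventures.PercRepro2.CoinTwoPendantDefs
import Summits.Ventures.PercRepro2.CoinTwoPendantMass
import Summits.Ventures.PercRepro2.CoinTraceLevels
import Summits.Ventures.PercRepro2.CoinTraceTower
import Summits.Ventures.PercRepro2.CoinTracePin
import Summits.Ventures.PercRepro2.CoinTraceReduce
import Summits.Ventures.PercRepro2.CoinTraceFn
import Summits.Ventures.PercRepro2.CoinTraceBlock
import Summits.Ventures.PercRepro2.CoinTraceShift
import Summits.Ventures.PercRepro2.CoinTwoStarAbstract
import Summits.Ventures.PercRepro2.CoinTwoStar
import Summits.Ventures.PercRepro2.CoinPivotalPair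
import Summits.Ventures.PercRepro2.CoinPivotalPairForce
import Summits.Ventures.PercRepro2.CoinContract

/-!
# Row 2′DARC at pendant heads with a TARGET SET `T` (blind cell PercRepro2, night-2 g3;
proofs/NIGHT2-DARC.md §18)

The gate functional is unchanged by contracting the target set `T` to one of its vertices `t₀`
(`phiC_gate_contract`: the avoidance, gate and marker events agree on `R_T`), so
`DARC p arcs s T a b u w ↔ DARC p (contract arcs T t₀) s {t₀} a b u w` (`darc_contract_iff`),
and the single-target theorems transfer: the 2-star (`darc_of_twoStar_mixed_set`), every head
with at most two pivotal traces (`darc_of_pivotal_pair_set`), the forcing heads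
(`darc_of_forcing_head_set`, `darc_of_forcing_all_set`), with the pendant set disjoint from `T`
and the reduced-event hypotheses stated in the original system.
-/

namespace Summit.Ventures.PercRepro2.Coin

section Transfer

open Classical

variable {V : Type*} {E : Type*} [DecidableEq V] [Fintype E] [DecidableEq E]
  {R : Type*} [Field R] [LinearOrder R] [IsStrictOrderedRing R]

omit [Fintype E] [DecidableEq E] [Field R] [LinearOrder R] [IsStrictOrderedRing R] in
/-- The avoidance event of `Z ∪ T` (`Z ∩ T = ∅`, `s ∉ T`) is that of `Z ∪ {t₀}` in the
contraction. -/
theorem avoidEvent_contract_union {T : Finset V} {t₀ : V} (ht₀ : t₀ ∈ T)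
    {arcs : E → Finset (V × V)} {s : V} (hs : s ∉ T) {Z : Finset V} (hZT : Disjoint Z T) :
    avoidEvent arcs s (Z ∪ T) = avoidEvent (contract arcs T t₀) s (Z ∪ {t₀}) := by
  ext ω
  simp only [avoidEvent, Set.mem_setOf_eq, Finset.mem_union, Finset.mem_singleton]
  constructor
  · rintro h x (hx | rfl) hr
    · have hxT : x ∉ T := fun h' => Finset.disjoint_left.mp hZT hx h'
      rcases reach_of_reach_contract ht₀ hs hr with ⟨_, h'⟩ | ⟨t, ht, hst⟩
      · exact h x (Or.inl hx) h'
      · exact h t (Or.inr ht) hst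
    · rcases reach_of_reach_contract ht₀ hs hr with ⟨h', _⟩ | ⟨t, ht, hst⟩
      · exact h' ht₀
      · exact h t (Or.inr ht) hst
  · rintro h x (hx | hx) hr
    · have hxT : x ∉ T := fun h' => Finset.disjoint_left.mp hZT hx h'
      have := reach_contract_of_reach (T := T) (t₀ := t₀) hr
      rw [rename_of_notMem hs, rename_of_notMem hxT] at this
      exact h x (Or.inl hx) this
    · have := reach_contract_of_reach (T := T) (t₀ := t₀) hr
      rw [rename_of_notMem hs, rename_of_mem hx] at this
      exact h t₀ (Or.inr rfl) this

omit [LinearOrder R] [IsStrictOrderedRing R] in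
/-- **The gate functional is unchanged by the contraction** (`s, a, b, u, w ∉ T`). -/
theorem phiC_gate_contract (p : E → R) {T : Finset V} {t₀ : V} (ht₀ : t₀ ∈ T)
    {arcs : E → Finset (V × V)} {s a b u w : V} (hs : s ∉ T) (ha : a ∉ T) (hb : b ∉ T)
    (hu : u ∉ T) (hw : w ∉ T) :
    phiC p arcs s T a b (gateEvent arcs s T u w) =
      phiC p (contract arcs T t₀) s {t₀} a b (gateEvent (contract arcs T t₀) s {t₀} u w) := by
  have hG : gateEvent arcs s T u w ⊆ avoidEvent arcs s T := by
    rw [gateEvent_eq_union]; exact Set.inter_subset_left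
  have hmX : ∀ ω ∈ avoidEvent arcs s T,
      marker (R := R) arcs s a ω = marker (R := R) (contract arcs T t₀) s a ω := by
    intro ω hω
    simp only [marker, reach_contract_iff_of_avoid ht₀ hs hω ha]
  have hmY : ∀ ω ∈ avoidEvent arcs s T,
      marker (R := R) arcs s b ω = marker (R := R) (contract arcs T t₀) s b ω := by
    intro ω hω
    simp only [marker, reach_contract_iff_of_avoid ht₀ hs hω hb]
  have hmXY : ∀ ω ∈ avoidEvent arcs s T,
      marker (R := R) arcs s a ω * marker (R := R) arcs s b ω =
        marker (R := R) (contract arcs T t₀) s a ω * marker (R := R) (contract arcs T t₀) s b ω :=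
    fun ω hω => by rw [hmX ω hω, hmY ω hω]
  unfold phiC
  simp only []
  rw [massE_congr' p hmX, massE_congr' p hmY, massE_congr' p (fun ω hω => hmX ω (hG hω)),
    massE_congr' p (fun ω hω => hmY ω (hG hω)), massE_congr' p (fun ω hω => hmXY ω (hG hω)),
    avoidEvent_contract ht₀ hs, gateEvent_contract ht₀ hs hu hw]

omit [IsStrictOrderedRing R] in
/-- `DARC` for the target set `T` is `DARC` for the single target `t₀` of the contraction. -/
theorem darc_contract_iff (p : E → R) {T : Finset V} {t₀ : V} (ht₀ : t₀ ∈ T)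
    {arcs : E → Finset (V × V)} {s a b u w : V} (hs : s ∉ T) (ha : a ∉ T) (hb : b ∉ T)
    (hu : u ∉ T) (hw : w ∉ T) :
    DARC p arcs s T a b u w ↔ DARC p (contract arcs T t₀) s {t₀} a b u w := by
  unfold DARC
  rw [phiC_gate_contract p ht₀ hs ha hb hu hw]

end Transfer

section Heads

open Classical

variable {V : Type*} {E : Type*} [Fintype V] [DecidableEq V] [Fintype E] [DecidableEq E]
  {R : Type*} [Field R] [LinearOrder R] [IsStrictOrderedRing R]

omit [Fintype V] [Fintype E] [DecidableEq E] in
/-- The reduced avoidance events of the contraction are those of the original system. -/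
lemma avoid_reduced_contract {T : Finset V} {t₀ : V} (ht₀ : t₀ ∈ T) {arcs : E → Finset (V × V)}
    {P : Finset V} (hPT : Disjoint P T) {s : V} (hs : s ∉ T) {Z : Finset V} (hZ : Z ⊆ P) :
    avoidEvent (arcsOff (contract arcs T t₀) (P ∪ {t₀})) s (Z ∪ {t₀}) =
      avoidEvent (arcsOff arcs (P ∪ T)) s (Z ∪ T) := by
  rw [arcsOff_contract ht₀ P, avoidEvent_contract_union ht₀ hs (Finset.disjoint_of_subset_left hZ hPT)]

omit [Fintype V] [Fintype E] [DecidableEq E] in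
/-- The reduced gate events of the contraction are those of the original system. -/
lemma avoid_reduced_gate_contract {T : Finset V} {t₀ : V} (ht₀ : t₀ ∈ T)
    {arcs : E → Finset (V × V)} {P : Finset V} (hPT : Disjoint P T) {s u w : V} (hs : s ∉ T)
    (hu : u ∉ T) {Z : Finset V} (hZ : Z ⊆ P) :
    avoidEvent (arcsOff (contract arcs T t₀) (P ∪ {t₀})) s (gateTarget u w Z {t₀}) =
      avoidEvent (arcsOff arcs (P ∪ T)) s (gateTarget u w Z T) := by
  unfold gateTarget
  split_ifs with hw
  · rw [← Finset.insert_union, ← Finset.insert_union, arcsOff_contract ht₀ P,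
      avoidEvent_contract_union ht₀ hs]
    rw [Finset.disjoint_insert_left]
    exact ⟨hu, Finset.disjoint_of_subset_left hZ hPT⟩
  · exact avoid_reduced_contract ht₀ hPT hs hZ

/-- **THEOREM (the 2-star head, target SET).** -/
theorem darc_of_twoStar_mixed_set (p : E → R) (hp : IsProbVec p) {arcs : E → Finset (V × V)}
    (hS : SameEnds arcs) (s a b u w v₁ v₂ : V) {T : Finset V} {t₀ : V} (ht₀ : t₀ ∈ T)
    (hwv₁ : w ≠ v₁) (hwv₂ : w ≠ v₂) (hv₁₂ : v₁ ≠ v₂)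
    (hPT : Disjoint ({w, v₁, v₂} : Finset V) T) (hs : s ∉ T)
    (hclosed : ClosedOut arcs {w, v₁, v₂} T) (hT : TailCoinsIn arcs {w, v₁, v₂} T)
    {c₁ c₂ : E} (hc₁ : c₁ ∈ tailCoins arcs {w, v₁, v₂}) (hleaf₁ : bwdEvent arcs v₁ T = openEdge c₁)
    (hc₂ : c₂ ∈ tailCoins arcs {w, v₁, v₂}) (hleaf₂ : bwdEvent arcs v₂ T = openEdge c₂)
    (hwexit : ∀ ω : Config E, ω ∈ bwdEvent arcs w T →
      ω ∈ bwdEvent arcs v₁ T ∨ ω ∈ bwdEvent arcs v₂ T)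
    (ha : a ∉ ({w, v₁, v₂} : Finset V) ∪ T) (hb : b ∉ ({w, v₁, v₂} : Finset V) ∪ T)
    (hu : u ∉ ({w, v₁, v₂} : Finset V) ∪ T)
    (hP : ∀ Z ∈ ({w, v₁, v₂} : Finset V).powerset,
      0 < prob p (avoidEvent (arcsOff arcs ({w, v₁, v₂} ∪ T)) s (Z ∪ T)))
    (hQ : ∀ Z ∈ ({w, v₁, v₂} : Finset V).powerset,
      0 < prob p (avoidEvent (arcsOff arcs ({w, v₁, v₂} ∪ T)) s (gateTarget u w Z T))) :
    DARC p arcs s T a b u w := by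
  have hwT : w ∉ T := Finset.disjoint_left.mp hPT (by simp)
  have hv₁T : v₁ ∉ T := Finset.disjoint_left.mp hPT (by simp)
  have hv₂T : v₂ ∉ T := Finset.disjoint_left.mp hPT (by simp)
  have haT : a ∉ T := fun h => ha (Finset.mem_union_right _ h)
  have hbT : b ∉ T := fun h => hb (Finset.mem_union_right _ h)
  have huT : u ∉ T := fun h => hu (Finset.mem_union_right _ h)
  rw [darc_contract_iff p ht₀ hs haT hbT huT hwT]
  refine darc_of_twoStar_mixed (c₁ := c₁) (c₂ := c₂) p hp (sameEnds_contract hS) s a b u w v₁ v₂ t₀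
    hwv₁ hwv₂ hv₁₂ (closedOut_contract ht₀ hPT hclosed) (tailCoinsIn_contract ht₀ hPT hT)
    (by rwa [tailCoins_contract ht₀ hPT]) (by rw [← bwdEvent_contract ht₀ hv₁T]; exact hleaf₁)
    (by rwa [tailCoins_contract ht₀ hPT]) (by rw [← bwdEvent_contract ht₀ hv₂T]; exact hleaf₂)
    (by rw [← bwdEvent_contract ht₀ hwT, ← bwdEvent_contract ht₀ hv₁T,
      ← bwdEvent_contract ht₀ hv₂T]; exact hwexit)
    ?_ ?_ ?_ ?_ ?_
  · intro h
    rcases Finset.mem_union.mp h with h | h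
    · exact ha (Finset.mem_union_left _ h)
    · exact haT (Finset.mem_singleton.mp h ▸ ht₀)
  · intro h
    rcases Finset.mem_union.mp h with h | h
    · exact hb (Finset.mem_union_left _ h)
    · exact hbT (Finset.mem_singleton.mp h ▸ ht₀)
  · intro h
    rcases Finset.mem_union.mp h with h | h
    · exact hu (Finset.mem_union_left _ h)
    · exact huT (Finset.mem_singleton.mp h ▸ ht₀)
  · intro Z hZ
    rw [avoid_reduced_contract ht₀ hPT hs (Finset.mem_powerset.mp hZ)]
    exact hP Z hZ
  · intro Z hZ
    rw [avoid_reduced_gate_contract ht₀ hPT hs huT (Finset.mem_powerset.mp hZ)]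
    exact hQ Z hZ

/-- **THEOREM (at most two pivotal traces, target SET).** -/
theorem darc_of_pivotal_pair_set (p : E → R) (hp : IsProbVec p) {arcs : E → Finset (V × V)}
    (hS : SameEnds arcs) {P T : Finset V} {t₀ : V} (ht₀ : t₀ ∈ T) (hPT : Disjoint P T)
    (hclosed : ClosedOut arcs P T) (hT : TailCoinsIn arcs P T) (s a b u w : V) (hs : s ∉ T)
    (hwP : w ∈ P) {Z₁ : Finset V} (hZ₁P : Z₁ ⊆ P) (hwZ₁ : w ∈ Z₁)
    (hlev : ∀ Z ∈ P.powerset, w ∈ Z → Z ≠ Z₁ → Z ≠ P → traceLevel arcs T P Z = ∅)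
    (ha : a ∉ P ∪ T) (hb : b ∉ P ∪ T) (hu : u ∉ P ∪ T)
    (hP : ∀ Z ∈ P.powerset, 0 < prob p (avoidEvent (arcsOff arcs (P ∪ T)) s (Z ∪ T)))
    (hQ : ∀ Z ∈ P.powerset, 0 < prob p (avoidEvent (arcsOff arcs (P ∪ T)) s (gateTarget u w Z T))) :
    DARC p arcs s T a b u w := by
  have hwT : w ∉ T := Finset.disjoint_left.mp hPT hwP
  have haT : a ∉ T := fun h => ha (Finset.mem_union_right _ h)
  have hbT : b ∉ T := fun h => hb (Finset.mem_union_right _ h)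
  have huT : u ∉ T := fun h => hu (Finset.mem_union_right _ h)
  rw [darc_contract_iff p ht₀ hs haT hbT huT hwT]
  refine darc_of_pivotal_pair p hp (sameEnds_contract hS) (closedOut_contract ht₀ hPT hclosed)
    (tailCoinsIn_contract ht₀ hPT hT) s a b u w hwP hZ₁P hwZ₁ ?_ ?_ ?_ ?_ ?_ ?_
  · intro Z hZ hw h₁ h₂
    have hZP : Z ⊆ P := Finset.mem_powerset.mp hZ
    rw [← hlev Z hZ hw h₁ h₂]
    ext ω
    simp only [traceLevel, Set.mem_setOf_eq]
    refine forall_congr' fun z => forall_congr' fun hz => ?_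
    rw [bwdEvent_contract ht₀ (Finset.disjoint_left.mp hPT hz)]
  · intro h
    rcases Finset.mem_union.mp h with h | h
    · exact ha (Finset.mem_union_left _ h)
    · exact haT (Finset.mem_singleton.mp h ▸ ht₀)
  · intro h
    rcases Finset.mem_union.mp h with h | h
    · exact hb (Finset.mem_union_left _ h)
    · exact hbT (Finset.mem_singleton.mp h ▸ ht₀)
  · intro h
    rcases Finset.mem_union.mp h with h | h
    · exact hu (Finset.mem_union_left _ h)
    · exact huT (Finset.mem_singleton.mp h ▸ ht₀)
  · intro Z hZ
    rw [avoid_reduced_contract ht₀ hPT hs (Finset.mem_powerset.mp hZ)]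
    exact hP Z hZ
  · intro Z hZ
    rw [avoid_reduced_gate_contract ht₀ hPT hs huT (Finset.mem_powerset.mp hZ)]
    exact hQ Z hZ


omit [Fintype V] [Fintype E] [DecidableEq E] in
/-- When `w` forces `Z₁` into `K⁻_T`, every trace containing `w` other than `Z₁` and
`insert v Z₁` has an empty level (target set version). -/
lemma traceLevel_eq_empty_of_forces_set {arcs : E → Finset (V × V)} {T : Finset V} {w v : V}
    {Z₁ : Finset V} (hwZ₁ : w ∈ Z₁) (hvZ₁ : v ∉ Z₁)
    (hforce : ∀ ω : Config E, ω ∈ bwdEvent arcs w T → ∀ z ∈ Z₁, ω ∈ bwdEvent arcs z T)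
    {Z : Finset V} (hZ : Z ∈ (insert v Z₁).powerset) (hw : w ∈ Z) (h₁ : Z ≠ Z₁)
    (h₂ : Z ≠ insert v Z₁) : traceLevel arcs T (insert v Z₁) Z = ∅ := by
  ext ω
  simp only [Set.mem_empty_iff_false, iff_false]
  intro hω
  have hZP : Z ⊆ insert v Z₁ := Finset.mem_powerset.mp hZ
  have hwK : ω ∈ bwdEvent arcs w T := (hω w (Finset.mem_insert_of_mem hwZ₁)).mp hw
  have hZ₁Z : Z₁ ⊆ Z := fun z hz =>
    (hω z (Finset.mem_insert_of_mem hz)).mpr (hforce ω hwK z hz)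
  by_cases hv : v ∈ Z
  · apply h₂
    ext z
    constructor
    · exact fun h => hZP h
    · intro h
      rcases Finset.mem_insert.mp h with rfl | h
      · exact hv
      · exact hZ₁Z h
  · apply h₁
    ext z
    constructor
    · intro h
      rcases Finset.mem_insert.mp (hZP h) with rfl | h'
      · exact absurd h hv
      · exact h'
    · exact fun h => hZ₁Z h

/-- **THEOREM (the head forces all pendant vertices but one, target SET):** two-vertex heads,
the diamond, the side-branch. -/
theorem darc_of_forcing_head_set (p : E → R) (hp : IsProbVec p) {arcs : E → Finset (V × V)}
    (hS : SameEnds arcs) {T : Finset V} {t₀ : V} (ht₀ : t₀ ∈ T) {w v : V} {Z₁ : Finset V}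
    (hwZ₁ : w ∈ Z₁) (hvZ₁ : v ∉ Z₁) (hPT : Disjoint (insert v Z₁) T)
    (hclosed : ClosedOut arcs (insert v Z₁) T) (hT : TailCoinsIn arcs (insert v Z₁) T)
    (hforce : ∀ ω : Config E, ω ∈ bwdEvent arcs w T → ∀ z ∈ Z₁, ω ∈ bwdEvent arcs z T)
    (s a b u : V) (hs : s ∉ T) (ha : a ∉ insert v Z₁ ∪ T) (hb : b ∉ insert v Z₁ ∪ T)
    (hu : u ∉ insert v Z₁ ∪ T)
    (hP : ∀ Z ∈ (insert v Z₁).powerset,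
      0 < prob p (avoidEvent (arcsOff arcs (insert v Z₁ ∪ T)) s (Z ∪ T)))
    (hQ : ∀ Z ∈ (insert v Z₁).powerset,
      0 < prob p (avoidEvent (arcsOff arcs (insert v Z₁ ∪ T)) s (gateTarget u w Z T))) :
    DARC p arcs s T a b u w :=
  darc_of_pivotal_pair_set p hp hS ht₀ hPT hclosed hT s a b u w hs (Finset.mem_insert_of_mem hwZ₁)
    (Finset.subset_insert v Z₁) hwZ₁
    (fun _ hZ hw h₁ h₂ => traceLevel_eq_empty_of_forces_set hwZ₁ hvZ₁ hforce hZ hw h₁ h₂)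
    ha hb hu hP hQ

/-- **THEOREM (the head forces the whole pendant set, target SET):** pendant paths of any length
with arbitrary entries, and every head whose only pivotal trace is `P`. -/
theorem darc_of_forcing_all_set (p : E → R) (hp : IsProbVec p) {arcs : E → Finset (V × V)}
    (hS : SameEnds arcs) {T : Finset V} {t₀ : V} (ht₀ : t₀ ∈ T) {P : Finset V} {w : V}
    (hwP : w ∈ P) (hPT : Disjoint P T) (hclosed : ClosedOut arcs P T) (hT : TailCoinsIn arcs P T)
    (hforce : ∀ ω : Config E, ω ∈ bwdEvent arcs w T → ∀ z ∈ P, ω ∈ bwdEvent arcs z T)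
    (s a b u : V) (hs : s ∉ T) (ha : a ∉ P ∪ T) (hb : b ∉ P ∪ T) (hu : u ∉ P ∪ T)
    (hP : ∀ Z ∈ P.powerset, 0 < prob p (avoidEvent (arcsOff arcs (P ∪ T)) s (Z ∪ T)))
    (hQ : ∀ Z ∈ P.powerset,
      0 < prob p (avoidEvent (arcsOff arcs (P ∪ T)) s (gateTarget u w Z T))) :
    DARC p arcs s T a b u w := by
  refine darc_of_pivotal_pair_set p hp hS ht₀ hPT hclosed hT s a b u w hs hwP (subset_refl P) hwP
    ?_ ha hb hu hP hQ
  intro Z hZ hw h₁ _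
  ext ω
  simp only [Set.mem_empty_iff_false, iff_false]
  intro hω
  apply h₁
  have hZP : Z ⊆ P := Finset.mem_powerset.mp hZ
  have hwK : ω ∈ bwdEvent arcs w T := (hω w hwP).mp hw
  exact Finset.Subset.antisymm hZP fun z hz => (hω z hz).mpr (hforce ω hwK z hz)

end Heads

end Summit.Ventures.PercRepro2.Coin
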